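import Literature.Geometry.DiscreteGeometry.EnergyLinearProgrammingBound

/-!
# The tangent-line (Jensen-type) energy bound: `N` points on `S^{n-1}`, any `N ≥ 2`

Framing: lottery ticket; floor = certified bounds/negative ranges. Venture `PackingBounds` (cell
`pub-packcert`, seat `pub-packcert-energy`), energy-minimisation family, **universal + control**.

**Theorem.** Let `n ≥ 3`, `N ≥ 2`, `t₀ = -1/(N-1)`, and let the potential `a : ℝ → ℝ` admit a
supporting line of slope `m ≥ 0` at `t₀` on `[-1,1)` (`a(t) ≥ a(t₀) + m (t - t₀)`), with
`a(t₀) + m/(N-1) ≥ 0`. Then every configuration `C` of `N` unit vectors of `ℝⁿ` satisfies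
`Σ_{x ≠ y ∈ C} a(⟨x, y⟩) ≥ N (N-1) · a(-1/(N-1))`.
This is the degree-one case of the LP bound; it is SHARP exactly when a regular simplex with `N`
vertices fits, i.e. `N ≤ n + 1` (Cohn–Kumar 2007, Table 1, first line: the regular simplices
`N ≤ n + 1` are universally optimal), and for larger `N` it is the elementary Jensen bound
(`Σ_{x≠y} ⟨x,y⟩ = |Σ x|² - N ≥ -N`). Companion of `SimplexUniversal.lean` (the case `N = n+1`).

## References
* H. Cohn, A. Kumar, J. Amer. Math. Soc. 20 (2007) 99–148, Thm. 1.2, Table 1, Prop. 4.1. [`CohnKumar2006`]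
-/

namespace Summit.Ventures.PackingBounds.Energy

open Finset Literature.Analysis.SpecialFunctions Literature.Geometry.DiscreteGeometry

open scoped Classical in
/-- **Tangent-line LP bound** (sharp for regular simplices, `N ≤ n+1`): for `n ≥ 3`, `N ≥ 2`,
`m ≥ 0`, `a(t) ≥ a(-1/(N-1)) + m (t + 1/(N-1))` on `[-1,1)` and `a(-1/(N-1)) + m/(N-1) ≥ 0`, every
`N`-set of unit vectors of `ℝⁿ` has `Σ_{x ≠ y} a(⟨x,y⟩) ≥ N (N-1) a(-1/(N-1))`.
[cite: CohnKumar2006, Theorem 1.2 and Proposition 4.1] -/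
theorem tangent_energy_ge {n : ℕ} (hn : 3 ≤ n) (N : ℕ) (hN2 : 2 ≤ N) (a : ℝ → ℝ) (m : ℝ)
    (hm : 0 ≤ m)
    (hsupp : ∀ t : ℝ, -1 ≤ t → t < 1 →
      a (-1 / ((N : ℝ) - 1)) + m * (t + 1 / ((N : ℝ) - 1)) ≤ a t)
    (ha0 : 0 ≤ a (-1 / ((N : ℝ) - 1)) + m / ((N : ℝ) - 1))
    (C : Finset (EuclideanSpace ℝ (Fin n))) (h1 : ∀ x ∈ C, ‖x‖ = 1) (hN : C.card = N) :
    (N : ℝ) * ((N : ℝ) - 1) * a (-1 / ((N : ℝ) - 1)) ≤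
      ∑ x ∈ C, ∑ y ∈ C.erase x, a (inner ℝ x y) := by
  have hn3 : (3 : ℝ) ≤ n := by exact_mod_cast hn
  have hN2' : (2 : ℝ) ≤ N := by exact_mod_cast hN2
  have hN1 : (0 : ℝ) < (N : ℝ) - 1 := by linarith
  set μ : ℝ := ((n : ℝ) - 2) / 2 with hμdef
  have hμ : 0 < μ := by rw [hμdef]; linarith
  have hnμ : (n : ℝ) = 2 * μ + 2 := by rw [hμdef]; ring
  set t₀ : ℝ := -1 / ((N : ℝ) - 1) with ht₀
  set α : ℕ → ℝ := fun k => if k = 0 then a t₀ + m / ((N : ℝ) - 1) else if k = 1 then m / (2 * μ)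
    else 0 with hαdef
  have hα : ∀ k, 0 ≤ α k := by
    intro k
    simp only [hαdef]
    split_ifs
    · exact ha0
    · exact div_nonneg hm (by positivity)
    · exact le_rfl
  have hpoly : ∀ t : ℝ, ∑ k ∈ range (1 + 1), α k * gegenbauerSum μ k t =
      a t₀ + m * (t + 1 / ((N : ℝ) - 1)) := by
    intro t
    simp only [Finset.sum_range_succ, Finset.sum_range_zero, gegenbauerSum_zero, gegenbauerSum_one,
      hαdef]
    simp only [if_true, one_ne_zero, if_false]
    field_simp
    ring
  have hH : ∀ t : ℝ, -1 ≤ t → t < 1 → ∑ k ∈ range (1 + 1), α k * gegenbauerSum μ k t ≤ a t := by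
    intro t ht1 ht2
    rw [hpoly t]
    exact hsupp t ht1 ht2
  have key := EnergyLP.energy_ge_inner hnμ hμ 1 α hα a hH C h1
  rw [hN, hpoly 1] at key
  have hα0 : α 0 = a t₀ + m / ((N : ℝ) - 1) := by simp [hαdef]
  rw [hα0] at key
  have hval : (N : ℝ) ^ 2 * (a t₀ + m / ((N : ℝ) - 1)) -
      (N : ℝ) * (a t₀ + m * (1 + 1 / ((N : ℝ) - 1))) = (N : ℝ) * ((N : ℝ) - 1) * a t₀ := by
    field_simp
    ring
  linarith [key, hval]

end Summit.Ventures.PackingBounds.Energy
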